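import Summits.QuantumFields.BalabanUV.T4Continuum.Support.ShellMeasureExpJacobianSUN
import Summits.QuantumFields.BalabanUV.T4Continuum.Support.ShellMeasureExpDuhamelSUN
import Literature.Analysis.Calculus.RealAnalyticZeroSetProofs

/-!
# `T4Continuum.ShellMeasureExpRegularConeSUN` — THE NON-REGULAR CONE OF THE EXPONENTIAL CHART OF `SU(N)` IS
# LEBESGUE-NULL: `volume {v : E_N | Re disc H(v) = 0} = 0`, i.e. almost every chart point has a generator with
# simple spectrum
(cell `pub-balaban`, sub-cell `t4`, spine estimate NE7c (node U5b); NE7c formalisation swarm, crew seat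
`b2b-balaban-t4-ne7c-formalise-leaf-08` gen 6 (v1.1 doc-only, gen 8); a SECOND, REDUNDANT proof of the CONE-NULLITY
brick of the (CH)₁-for-`SU(N)` line — see DEPRECATED below (route memo
`HOME/b2b-balaban-t4-ne7c-formalise-leaf-09/g5/ROUTE-CH1-SUN.md`; journal claims l.10111 STEP 1 (landed p214579),
l.10254 STEP 2, l.10221 (H)∕(AF), l.10741 this file); row S3 «SM-L9 SU(N) chart» of
`t4/b2b-balaban-t4-ne7c-p1/LEAVES-NE7c-P1.md`, trigger c5: OPTIONAL and last; imports S3 f4 `ShellMeasureExpJacobianSUN`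
(`herm`, `disc`, `conjDiag`, `disc_conjDiag_re`), STEP 1 `ShellMeasureExpDuhamelSUN` (the linear chart map `genSUL`) and
the tree's `Literature.Analysis.Calculus.RealAnalyticZeroSetProofs` (Mityagin's theorem, PROVED there) ONLY; ADDITIVE;
0 `def … : Prop`, 0 sorry, 0 citations — [folklore] analysis)

HONEST FRAMING.  Finite four-torus programme, rung (B)+1 only — NOT infinite volume, NOT a mass gap, NOT the Clay
problem, NOT summit progress.  NE7c NOT PRINTED, NOT PROVED; «NE7c ⇐ the named binders».  Nothing of Bałaban's here.
STATUS (v1.1, gen 8, doc-only; every declaration byte-identical with v1 p214927).  (CH)₁ has since become a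
THEOREM for every `N ≥ 1`, `0 ≤ S ≤ π`: `ShellMeasureExpHaarAreaSUN.haar_restrict_expBallSU` (p214997, `S < π`) and
`ShellMeasureExpHaarClosedBallSUN.haar_restrict_expBallSU_le` (p215095, `S ≤ π`) — assembled from STEP 1, STEP 2,
(H) and the cone-nullity of `ShellMeasureRegularConeSUN` (NOT of this file).  This changes nothing in the countdown
(row S3 is c5-optional; SU(2) is the certified instance).

DEPRECATED — DO NOT IMPORT (crew referee pass 9, DV-20; the author's DUPLICATE NOTICE, journal l.10838).  This module
DUPLICATES the mathematical content of `ShellMeasureRegularConeSUN` (crew seat leaf-10 gen 5, p214857, proposed five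
minutes earlier; headline `volume_nonRegular_eq_zero`, a.e. form `ae_disc_herm_re_ne_zero`, via
`Literature.MeasureTheory.Lebesgue.PolynomialZeroSet`), which is the ONLY cone file in the import cone of the (AF)∕(CB)
assembly.  The present file is kept as an INDEPENDENT SECOND PROOF (Mityagin's real-analytic zero-set theorem instead of
the polynomial zero-set lemma) — a cross-check, not a building block: new modules needing the cone-nullity import
`ShellMeasureRegularConeSUN`, never this file; nothing in the tree imports it and nothing should.

WHY.  S3 f4 DEFINES the exponential Haar Jacobian by the determinant formula
`expJacSU v = Re udisc(e^{genSU v}) ∕ Re disc(H(v))`, which equals the root-space product `∏_{i<j} sinc²((θ_j−θ_i)∕2)`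
only where the Hermitian generator `H(v) = −i·genSU v` is REGULAR (`Re disc H(v) = (∏_{i<j}(θ_j−θ_i))² ≠ 0`,
`expJacSU_eq_prod_sinc`) and is `0` on the non-regular cone (`expJacSU_eq_zero`); the determinant headline of STEP 2
(`det T_v = ∏ sinc²`) therefore identifies `det T_v` with `expJacSU v` only OFF the cone, and the area-formula file
(AF) needs the identity Lebesgue-ALMOST EVERYWHERE (`hJ`).  This file proves the cone is null.
* §1 ANALYTICITY: `v ↦ H(v)` is real-linear (`hermL = (−i)·genSUL`), so `v ↦ H(v)^m`, `v ↦ tr H(v)^m` and — by the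
  Leibniz expansion of `disc = det [tr H^{a+b}]` — `v ↦ disc H(v)` and `v ↦ Re disc H(v)` are real-analytic on
  `E_N = EuclideanSpace ℝ (Fin d_N)` (`analyticOnNhd_disc_herm_re`; the `Matrix` norm scope (Frobenius) is opened only
  inside this section, statements about `disc ∘ herm` are norm-free).
* §2 A REGULAR DIRECTION: `θ_k = 2k − (N−1)` sums to `0` (`sum_regDiag`) and has distinct entries
  (`prod_regDiag_sub_ne_zero`).
* §3 THE WITNESS `regPt N = coordSU⁻¹ (i·diag θ)` (`regGen_mem`: skew-Hermitian, traceless; `herm_regPt`: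
  `H = conjDiag 1 θ`), `disc_herm_regPt_re_ne_zero`, and the headline **`volume_nonregular_eq_zero`** by
  `Literature.Analysis.Calculus.realAnalytic_zeroSet_null_holds` on the connected open `univ`, with the a.e. forms
  **`ae_disc_herm_re_ne_zero`** ∕ `ae_restrict_disc_herm_re_ne_zero` (the shape the (AF) assembly consumes together with
  STEP 2's `det_eq_expJacSU (hreg : (disc (herm v)).re ≠ 0)`).
HONEST DEPENDENCY (cell): continuum YM on T⁴ ⇐ BetaPertH ∧ nine spine estimates (0/9 proved); BetaPertH ⇐ (D1) ∧ (D4) ∧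
CAP+tail; G-an2-4 gates asym, D1 and NE2/3/4.
-/

noncomputable section

open MeasureTheory Set Matrix Finset

namespace Summit.QuantumFields.BalabanUV.T4Continuum.ShellMeasureExpRegularConeSUN

open Literature.MathematicalPhysics.QuantumFieldTheory.Balaban1983to89
open T4AdjointCovarianceUnitary (lieSU mem_lieSU_iff)
open ShellMeasureVandermondeSUN ShellMeasureExpChartSUN ShellMeasureExpJacobianSUN ShellMeasureExpDuhamelSUN

variable {N : ℕ}

/-! ## §1 The discriminant of the Hermitian generator is a real-analytic function of the chart point -/

section Analytic

open scoped Matrix.Norms.Frobenius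

/-- the Hermitian generator `H(v) = −i·genSU v` as a continuous real-linear map `E_N →L[ℝ] M_N(ℂ)`
(Frobenius scope on the target). [folklore] -/
def hermL := (-Complex.I) • genSUL (N := N)

/-- `hermL v = herm v`. [folklore] -/
@[simp] theorem hermL_apply (v : ChartSU N) : hermL v = herm v := rfl

/-- `v ↦ H(v)` is real-analytic (it is real-linear). [folklore] -/
theorem analyticOnNhd_herm : AnalyticOnNhd ℝ (herm (N := N)) univ := by
  have h := (hermL (N := N)).analyticOnNhd univ
  exact h

/-- `v ↦ H(v)^m` is real-analytic. [folklore] -/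
theorem analyticOnNhd_herm_pow (m : ℕ) : AnalyticOnNhd ℝ (fun v : ChartSU N => herm v ^ m) univ :=
  analyticOnNhd_herm.pow m

/-- the trace as a continuous real-linear functional on `M_N(ℂ)` (Frobenius scope). [folklore] -/
def traceL := LinearMap.toContinuousLinearMap
  ((Matrix.traceLinearMap (Fin N) ℂ ℂ).restrictScalars ℝ : Matrix (Fin N) (Fin N) ℂ →ₗ[ℝ] ℂ)

/-- `traceL M = trace M`. [folklore] -/
@[simp] theorem traceL_apply (M : Matrix (Fin N) (Fin N) ℂ) : traceL M = trace M := rfl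

/-- `v ↦ tr H(v)^m` is real-analytic (`ℂ`-valued). [folklore] -/
theorem analyticOnNhd_trace_herm_pow (m : ℕ) :
    AnalyticOnNhd ℝ (fun v : ChartSU N => trace (herm v ^ m)) univ :=
  (traceL (N := N)).comp_analyticOnNhd (analyticOnNhd_herm_pow m)

/-- one term of the Leibniz expansion of `disc H(v)` is real-analytic. [folklore] -/
theorem analyticOnNhd_disc_term (σ : Equiv.Perm (Fin N)) :
    AnalyticOnNhd ℝ (fun v : ChartSU N =>
      ((Equiv.Perm.sign σ : ℤ) : ℂ) * ∏ i : Fin N, trace (herm v ^ ((σ i : ℕ) + i))) univ := by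
  have h := Finset.analyticOnNhd_prod (𝕜 := ℝ) (Finset.univ : Finset (Fin N))
    (f := fun (i : Fin N) (v : ChartSU N) => trace (herm v ^ ((σ i : ℕ) + i)))
    (fun i _ => analyticOnNhd_trace_herm_pow ((σ i : ℕ) + i))
  have hfun : (fun v : ChartSU N => ∏ i : Fin N, trace (herm v ^ ((σ i : ℕ) + i))) =
      ∏ i : Fin N, fun v : ChartSU N => trace (herm v ^ ((σ i : ℕ) + i)) := by
    funext v
    simp only [Finset.prod_apply]
  have hp : AnalyticOnNhd ℝ (fun v : ChartSU N => ∏ i : Fin N, trace (herm v ^ ((σ i : ℕ) + i))) univ := by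
    rw [hfun]
    exact h
  exact analyticOnNhd_const.mul hp

/-- **`v ↦ disc H(v)` IS REAL-ANALYTIC** (`disc = det [tr H^{a+b}]`, a polynomial in the power traces). [folklore] -/
theorem analyticOnNhd_disc_herm : AnalyticOnNhd ℝ (fun v : ChartSU N => disc (herm v)) univ := by
  have hdet : (fun v : ChartSU N => disc (herm v)) =
      ∑ σ : Equiv.Perm (Fin N), fun v : ChartSU N => ((Equiv.Perm.sign σ : ℤ) : ℂ) *
        ∏ i : Fin N, trace (herm v ^ ((σ i : ℕ) + i)) := by
    funext v
    rw [Finset.sum_apply, disc, det_apply]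
    refine Finset.sum_congr rfl fun σ _ => ?_
    rw [Units.smul_def, zsmul_eq_mul]
    rfl
  rw [hdet]
  exact Finset.analyticOnNhd_sum _ fun σ _ => analyticOnNhd_disc_term σ

/-- **`v ↦ Re disc H(v)` IS REAL-ANALYTIC.** [folklore] -/
theorem analyticOnNhd_disc_herm_re : AnalyticOnNhd ℝ (fun v : ChartSU N => (disc (herm v)).re) univ :=
  Complex.reCLM.comp_analyticOnNhd analyticOnNhd_disc_herm

end Analytic

/-! ## §2 A regular point: the chart point of the traceless diagonal generator with distinct entries -/

/-- the real diagonal `θ_k = 2k − (N − 1)` (distinct entries summing to zero). [folklore] -/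
def regDiag (N : ℕ) (k : Fin N) : ℝ := 2 * (k : ℝ) - ((N : ℝ) - 1)

/-- `Σ_{k<N} k = N(N−1)/2` over `Fin N`, in `ℝ`. [folklore] -/
theorem sum_fin_val_mul_two : (∑ k : Fin N, ((k : ℕ) : ℝ)) * 2 = (N : ℝ) * ((N : ℝ) - 1) := by
  have h := Finset.sum_range_id_mul_two N
  rcases Nat.eq_zero_or_pos N with h0 | hpos
  · subst h0; simp
  · have hcast : (((N * (N - 1) : ℕ)) : ℝ) = (N : ℝ) * ((N : ℝ) - 1) := by
      rw [Nat.cast_mul, Nat.cast_sub hpos, Nat.cast_one]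
    rw [← hcast, ← h, Nat.cast_mul, Nat.cast_sum, Fin.sum_univ_eq_sum_range (fun i => ((i : ℕ) : ℝ)) N,
      Nat.cast_two]

/-- `Σ_k θ_k = 0`. [folklore] -/
theorem sum_regDiag : ∑ k : Fin N, regDiag N k = 0 := by
  unfold regDiag
  rw [Finset.sum_sub_distrib, Finset.sum_const, Finset.card_univ, Fintype.card_fin, nsmul_eq_mul,
    ← Finset.mul_sum]
  have h := sum_fin_val_mul_two (N := N)
  linarith

/-- distinct entries: `θ_j − θ_i = 2(j − i) ≠ 0` for `i < j`. [folklore] -/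
theorem prod_regDiag_sub_ne_zero : ∏ i : Fin N, ∏ j ∈ Ioi i, (regDiag N j - regDiag N i) ≠ 0 := by
  refine Finset.prod_ne_zero_iff.mpr fun i _ => Finset.prod_ne_zero_iff.mpr fun j hj => ?_
  have hij : i < j := Finset.mem_Ioi.mp hj
  have hij' : ((i : ℕ) : ℝ) < ((j : ℕ) : ℝ) := Nat.cast_lt.mpr (Fin.lt_def.mp hij)
  unfold regDiag
  linarith

/-! ## §3 The regular witness and the nullity of the non-regular cone -/

section Null

/-- the generator `i·diag(θ)` of the regular witness: skew-Hermitian and traceless. [folklore] -/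
theorem regGen_mem :
    Complex.I • diagonal (fun k : Fin N => ((regDiag N k : ℝ) : ℂ)) ∈ lieSU (Fin N) := by
  rw [mem_lieSU_iff]
  refine ⟨?_, ?_⟩
  · rw [star_eq_conjTranspose, conjTranspose_smul, diagonal_conjTranspose, Complex.star_def, Complex.conj_I,
      neg_smul]
    have hst : star (fun k : Fin N => ((regDiag N k : ℝ) : ℂ)) = fun k => ((regDiag N k : ℝ) : ℂ) := by
      funext k
      exact Complex.conj_ofReal _
    rw [hst]
  · rw [trace_smul, trace_diagonal, ← Complex.ofReal_sum, sum_regDiag, Complex.ofReal_zero, smul_zero]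

/-- THE REGULAR WITNESS: the chart point of `i·diag(2k − (N−1))`. [folklore] -/
def regPt (N : ℕ) : ChartSU N :=
  (coordSU (N := N)).symm ⟨Complex.I • diagonal (fun k : Fin N => ((regDiag N k : ℝ) : ℂ)), regGen_mem⟩

/-- its Hermitian generator is the diagonal `diag θ = conjDiag 1 θ`. [folklore] -/
theorem herm_regPt : herm (regPt N) = conjDiag 1 (fun k : Fin N => ((regDiag N k : ℝ) : ℂ)) := by
  have hg : genSU (regPt N) = Complex.I • diagonal (fun k : Fin N => ((regDiag N k : ℝ) : ℂ)) := by
    show ((coordSU ((coordSU (N := N)).symm _) : lieSU (Fin N)) : Matrix (Fin N) (Fin N) ℂ) = _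
    rw [LinearIsometryEquiv.apply_symm_apply]
  unfold herm
  rw [hg, smul_smul, neg_mul, Complex.I_mul_I, neg_neg, one_smul, conjDiag]
  simp

/-- at the witness the discriminant is `(∏_{i<j} 2(j − i))² ≠ 0`. [folklore] -/
theorem disc_herm_regPt_re_ne_zero : (disc (herm (regPt N))).re ≠ 0 := by
  rw [herm_regPt, disc_conjDiag_re]
  exact pow_ne_zero 2 prod_regDiag_sub_ne_zero

/-- **THE NON-REGULAR CONE OF THE EXPONENTIAL CHART OF `SU(N)` IS LEBESGUE-NULL**: the set of chart points whose
Hermitian generator has a repeated eigenvalue — `{v | Re disc H(v) = 0}`, where S3 f4's determinant formula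
`expJacSU` is set to `0` instead of the root-space product — has Lebesgue measure zero in `E_N`.  Proof: `Re disc H(v)`
is a real-analytic (polynomial) function on the connected space `E_N`, not identically zero (§2's witness), so its zero
set is null by Mityagin's theorem (`Literature.Analysis.Calculus.realAnalytic_zeroSet_null_holds`, PROVED in the tree).
[folklore] -/
theorem volume_nonregular_eq_zero : volume {v : ChartSU N | (disc (herm v)).re = 0} = 0 := by
  have h := Literature.Analysis.Calculus.realAnalytic_zeroSet_null_holds (dimSU N) univ
    (fun v : ChartSU N => (disc (herm v)).re) isOpen_univ isConnected_univ
    (analyticOnNhd_disc_herm_re (N := N)) ⟨regPt N, mem_univ _, disc_herm_regPt_re_ne_zero⟩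
  simpa only [mem_univ, true_and] using h

/-- **ALMOST EVERY CHART POINT IS REGULAR**: `Re disc H(v) ≠ 0` for Lebesgue-a.e. `v` — the hypothesis `hreg` of the
determinant headline `ShellMeasureExpDuhamelDetSUN.det_eq_expJacSU` holds a.e., so `det T_v = expJacSU v` a.e. (the
`hJ` input of the area-formula file (AF)). [folklore] -/
theorem ae_disc_herm_re_ne_zero : ∀ᵐ v : ChartSU N ∂volume, (disc (herm v)).re ≠ 0 := by
  rw [ae_iff]
  simpa only [not_not] using volume_nonregular_eq_zero (N := N)

/-- the same restricted to any set (e.g. the closed chart ball of (AF)). [folklore] -/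
theorem ae_restrict_disc_herm_re_ne_zero (s : Set (ChartSU N)) :
    ∀ᵐ v : ChartSU N ∂(volume.restrict s), (disc (herm v)).re ≠ 0 :=
  ae_restrict_of_ae ae_disc_herm_re_ne_zero

end Null

end Summit.QuantumFields.BalabanUV.T4Continuum.ShellMeasureExpRegularConeSUN
end
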